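import Mathlib.RingTheory.GradedAlgebra.Basic
import Mathlib.RingTheory.Ideal.Span
import HarnessLib

/-!
# Crux `FrobeniusLadder.FRationalResolution` (stmt-ResolutionOfSingularities-15317), line `redirect`,
# stub `stub_diagonalizableQuotientResolution` — census item R3-p(a), first input: a prime FIXED
# for the coarsened grading `A/B` splits into HOMOGENEOUS elements of degree `∉ B` plus its
# `B`-isotypic part (so the nonzero-degree parameters of the reduced chart can be chosen
# `A`-homogeneous)

At a point `𝔔` of the chart ring `S` (graded by `A`) with unit-degree subgroup `B = B_𝔔`, every
piece `S_a`, `a ∉ B`, lies in `𝔔` (`…StabilizerSubgroup`): `𝔔` is fixed for the `A/B`-coarsened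
grading. The repair census (this generation's diagnosis, item R3-p) needs the parameters of NONZERO
`A/B`-degree in a regular system of parameters at `𝔔` to be `A`-HOMOGENEOUS (only those can be
twisted into degree `0` by homogeneous units); this file proves the ideal-theoretic statement
behind it:

* `sub_mem_span_of_fixed` — every `q ∈ 𝔔` is `q = q_B + (q − q_B)` with `q_B ∈ 𝔔` supported in
  degrees `∈ B` (all components of degree `∉ B` vanish) and `q − q_B` in the ideal generated by the
  HOMOGENEOUS elements of degree `∉ B` (all of which lie in `𝔔`);
* `eq_span_homogeneous_sup` — **`𝔔 = ⟨S_a : a ∉ B⟩ + ⟨q ∈ 𝔔 : q supported on B⟩`** as ideals.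

Honest label: brick of R3-p(a) (no stub closed; the Nakayama selection of the reduced regular
system of parameters and the reduced Kato ideal are not here). No definitions, no named facts,
no sorry. [folklore; cite: SGA3, Exp. VIII §4–5]
-/

noncomputable section

-- single-problem summit: the doubled namespace component is forced
set_option linter.dupNamespace false

open DirectSum

namespace Summit.ResolutionOfSingularities.ResolutionOfSingularities.Theorems.FRationalResolution.FixedPrimeSplit

universe u v w

variable {k : Type u} [CommRing k] {A : Type w} [DecidableEq A] [AddCommGroup A] {S : Type v}
  [CommRing S] [Algebra k S] (𝒮 : A → Submodule k S) [GradedAlgebra 𝒮]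

/-- **Splitting an element of a fixed prime.** If `S_a ⊆ 𝔔` for all `a ∉ B`, then every `q ∈ 𝔔`
differs from an element `q_B ∈ 𝔔` all of whose components of degree `∉ B` vanish by an element
of the ideal generated by the homogeneous elements of degree `∉ B`.
[folklore; cite: SGA3, Exp. VIII §4–5] -/
theorem sub_mem_span_of_fixed (B : AddSubgroup A) (𝔔 : Ideal S)
    (hfix : ∀ a : A, a ∉ B → ∀ s ∈ 𝒮 a, s ∈ 𝔔) {q : S} (hq : q ∈ 𝔔) :
    ∃ qB : S, qB ∈ 𝔔 ∧ (∀ a : A, a ∉ B → (decompose 𝒮 qB a : S) = 0) ∧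
      q - qB ∈ Ideal.span {s : S | ∃ a : A, a ∉ B ∧ s ∈ 𝒮 a} := by
  classical
  set J : Ideal S := Ideal.span {s : S | ∃ a : A, a ∉ B ∧ s ∈ 𝒮 a} with hJ
  have hJQ : J ≤ 𝔔 := by
    rw [hJ, Ideal.span_le]
    rintro s ⟨a, haB, hs⟩
    exact hfix a haB s hs
  -- the `B`-part and the rest
  let qB : S := ∑ a ∈ (decompose 𝒮 q).support with a ∈ B, (decompose 𝒮 q a : S)
  let qN : S := ∑ a ∈ (decompose 𝒮 q).support with a ∉ B, (decompose 𝒮 q a : S)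
  have hsum : qB + qN = q := by
    simp only [qB, qN]
    rw [Finset.sum_filter_add_sum_filter_not]
    exact sum_support_decompose 𝒮 q
  have hqN : qN ∈ J := by
    refine Submodule.sum_mem J fun a ha => ?_
    rw [Finset.mem_filter] at ha
    exact Ideal.subset_span ⟨a, ha.2, (decompose 𝒮 q a).2⟩
  refine ⟨qB, ?_, ?_, ?_⟩
  · have h : qB = q - qN := by rw [← hsum]; ring
    rw [h]
    exact 𝔔.sub_mem hq (hJQ hqN)
  · intro a haB
    have h : GradedRing.proj 𝒮 a qB = 0 := by
      simp only [qB, map_sum]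
      refine Finset.sum_eq_zero fun c hc => ?_
      rw [Finset.mem_filter] at hc
      have hne : c ≠ a := fun h => haB (h ▸ hc.2)
      rw [GradedRing.proj_apply, decompose_of_mem_ne 𝒮 (decompose 𝒮 q c).2 hne]
    simpa only [GradedRing.proj_apply] using h
  · have h : q - qB = qN := by rw [← hsum]; ring
    rw [h]
    exact hqN

/-- **A prime fixed for the `A/B`-coarsened grading is generated by the homogeneous elements of
degree `∉ B` together with its elements supported on `B`.** [folklore; cite: SGA3, Exp. VIII §4–5] -/
theorem eq_span_homogeneous_sup (B : AddSubgroup A) (𝔔 : Ideal S)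
    (hfix : ∀ a : A, a ∉ B → ∀ s ∈ 𝒮 a, s ∈ 𝔔) :
    𝔔 = Ideal.span {s : S | ∃ a : A, a ∉ B ∧ s ∈ 𝒮 a} ⊔
      Ideal.span {q : S | q ∈ 𝔔 ∧ ∀ a : A, a ∉ B → (decompose 𝒮 q a : S) = 0} := by
  classical
  apply le_antisymm
  · intro q hq
    obtain ⟨qB, hqB, hqB0, hdiff⟩ := sub_mem_span_of_fixed 𝒮 B 𝔔 hfix hq
    have h : q = (q - qB) + qB := by ring
    rw [h]
    exact Submodule.add_mem_sup hdiff (Ideal.subset_span ⟨hqB, hqB0⟩)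
  · refine sup_le ?_ ?_
    · rw [Ideal.span_le]
      rintro s ⟨a, haB, hs⟩
      exact hfix a haB s hs
    · rw [Ideal.span_le]
      rintro s ⟨hs, -⟩
      exact hs

end Summit.ResolutionOfSingularities.ResolutionOfSingularities.Theorems.FRationalResolution.FixedPrimeSplit

end
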